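import Summits.BirchSwinnertonDyer.BirchSwinnertonDyer.Theses.SchneiderFreeAdditiveX3
import HarnessLib

/-!
# BC3 skeleton — TARGET `StepLOnCells` (rank 0) of route `SchneiderFreeAdditiveX3` (cell bsd-schneider-ideate, seat P2 «around», g6)

The target `X` = STEP L (`X11b.IndexLowerBoundAt` at every admissible Heegner datum, packaged as
`SchneiderFree.AdditiveStepLInputAt W p`) on row B6's reducible semistable-twist cells in analytic rank one.
The ROUTE decomposes `X` by MECHANISM (cruxes `BranchMCPotMult`, `BranchMCPotGoodTwo` = the "⊇" IMC
divisibility per `j`-regime; `AdditiveAnticycControl` = control; support `StepLLink` = the kernel link). This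
skeleton records the orthogonal decomposition by REGIME — `SubSemistableTwist W p := SubM W p ∨ SubGordTwo W p`
(`Additive/SharpenedStatements.lean`) — so that the potentially-multiplicative regime (M) can be CLOSED on its own
as soon as `BranchMCPotMult` + the (M)-half of `AdditiveAnticycControl` land, independently of the
`j ∈ {0,1728}`-free potentially-good quadratic regime (G-ord, `e = 2`):

* `stub_stepL_potMult` (size L) — STEP L on the (M) cells (`v_p(j) < 0`; 4 442 of the 7 101 pairs in kit
  j243439's census are (M) — see memos/census-P2-g4): `BranchMCPotMult` + control on (M) + `StepLLink`'s kernel.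
* `stub_stepL_gordTwo` (size L) — STEP L on the (G-ord, `e = 2`) cells: `BranchMCPotGoodTwo` + control + link.

Neither stub is an item of the route (no costume): each is STRICTLY between one branch crux and the target.
Sorries ONLY inside `stub_*`; `StepLOnCells_of` is a real proof (case split on the `Or`) concluding the ROUTE
decl `Summit.BirchSwinnertonDyer.BirchSwinnertonDyer.Theses.SchneiderFreeAdditiveX3.StepLOnCells` BY NAME.
-/

noncomputable section

section BirthSkeleton

set_option linter.dupNamespace false

open scoped Classical

open WeierstrassCurve NumberField IsDedekindDomain Field Literature.NumberTheory.EllipticCurves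
  Literature.NumberTheory.EllipticCurves.ModularForms
  Literature.NumberTheory.EllipticCurves.GreenbergSelmer
  Literature.NumberTheory.EllipticCurves.Rank1Residual
  Literature.NumberTheory.EllipticCurves.Rank1Residual.Typed
  Summit.BirchSwinnertonDyer.Rank1Residual
  Summit.BirchSwinnertonDyer.Rank1Residual.X11b
  Summit.BirchSwinnertonDyer.Rank1Residual.X11b.AcSelmer
  Summit.BirchSwinnertonDyer.Rank1Residual.X11b.Halves

namespace Summit.BirchSwinnertonDyer.BirchSwinnertonDyer.Cruxes.StepLOnCells.Birth

/-- STUB 1 (size L): **STEP L on the potentially-multiplicative cells (M).** For every globally minimal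
`E/ℚ` with `r_an = 1`, odd additive `p` with `E[p]` reducible (`ClassX3`) and `v_p(j) < 0` (`SubM`, i.e.
`E ≃ E'^{(±p)}` with `E'` multiplicative at `p`): the typed STEP L input at every admissible Heegner datum.
Plan: `BranchMCPotMult` (the "⊇" divisibility of the twisted-branch IMC at the trivial character, Skinner 2016
shape transported through the quadratic twist) + the (M)-half of `AdditiveAnticycControl` + the kernel link of
`StepLLink`. Why it might fail: the reducible-`E[p]` (Eisenstein) case of the multiplicative-branch "⊇" is in
print only at `p ∥ N` with extra image hypotheses. [cite: Skinner2016PacificMC, Thm. C]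
[cite: JetchevSkinnerWan2017, §7.4.1] -/
theorem stub_stepL_potMult :
    ∀ (W : WeierstrassCurve ℚ) [W.IsElliptic] [W.IsGloballyMinimal] (p : ℕ) [Fact p.Prime],
      W.analyticRank = 1 → p ≠ 2 → ClassX3 W p → Additive.SubM W p →
      Summit.BirchSwinnertonDyer.BirchSwinnertonDyer.Theorems.SchneiderFree.AdditiveStepLInputAt W p := by
  sorry

/-- STUB 2 (size L): **STEP L on the potentially-good-ordinary quadratic-twist cells (G-ord, `e = 2`).** Same
binders with `SubGordTwo` (`E^{(p*)}` good ordinary at `p`, semistability index `2`). Plan: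
`BranchMCPotGoodTwo` (the "⊇" divisibility of Greenberg–Vatsal / Kato type for the good-ordinary twist at a
reducible `E[p]`, transported) + the (G-ord)-half of `AdditiveAnticycControl` + the kernel link. Why it might
fail: at `p = 3` (6 794 of the row's pairs) the printed Eisenstein-prime main conjectures want `p ≥ 5`.
[cite: GreenbergVatsal2000, Thm. 3.12] [cite: JetchevSkinnerWan2017, §7.4.1] -/
theorem stub_stepL_gordTwo :
    ∀ (W : WeierstrassCurve ℚ) [W.IsElliptic] [W.IsGloballyMinimal] (p : ℕ) [Fact p.Prime],
      W.analyticRank = 1 → p ≠ 2 → ClassX3 W p → Additive.SubGordTwo W p →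
      Summit.BirchSwinnertonDyer.BirchSwinnertonDyer.Theorems.SchneiderFree.AdditiveStepLInputAt W p := by
  sorry

/-- COMPOSITION (kernel-checked, no sorry): `SubSemistableTwist W p` IS `SubM W p ∨ SubGordTwo W p`
(definitionally); case split. Concludes the ROUTE decl BY NAME. [folklore] -/
theorem StepLOnCells_of :
    Summit.BirchSwinnertonDyer.BirchSwinnertonDyer.Theses.SchneiderFreeAdditiveX3.StepLOnCells := by
  intro W _ _ p _ hr hp2 hX hS
  have hS' : Additive.SubM W p ∨ Additive.SubGordTwo W p := hS
  rcases hS' with hM | hG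
  · exact stub_stepL_potMult W p hr hp2 hX hM
  · exact stub_stepL_gordTwo W p hr hp2 hX hG

end Summit.BirchSwinnertonDyer.BirchSwinnertonDyer.Cruxes.StepLOnCells.Birth

end BirthSkeleton

end
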